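import Summits.AnomalousDissipation.AnomalousDissipation.Theorems.BaireTransferRobustLoudUpgradeStubLsFamilyA
import Summits.AnomalousDissipation.AnomalousDissipation.Theorems.BaireTransferRobustLoudUpgradeStubLsFamilyPhase
import Literature.Analysis.Calculus.BorderedSecondOrder
import Literature.Analysis.FunctionSpaces.TorusClassicalNSUniqueness

/-!
# Stub `stub_lsFold` of the line `malkin-cone-group-orbits` (crux stmt-AnomalousDissipation-1144, companion c2):
# TRANSVERSAL FOLDS of steady states are robust crossings (saddle-node in the force family)

Registered stub `stub_lsFold` (Pi-form), proved here.  Setting of `…StubLsFamilyB.lean` (simply degenerate mean-zero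
classical steady state `u₀` of `NS_ν(f_c)`, real kernel field `v`, admissible border field `h ∉ range L(ν,u₀)`; the
lattice set-up §1–§9 is repeated verbatim because the Lyapunov–Schmidt family lives on the lattice), plus two classical
jet hypotheses: the FOLD condition `(v·∇)v ∉ range L(ν,u₀)` (the quadratic coefficient of the reduced function along
the kernel is non-zero) and ONE first-order-visible force direction `d ∈ P_S` (`f_d ∉ range L(ν,u₀)`).  Conclusion:
the family `σ` (pinned classically by the same existence data as in `stub_lsFamily`: corrected forces `f_{c'} − σ h`
carrying lattice-close steady states of phase `x`) changes sign in `x` at forces `c + s d` arbitrarily close to `c` —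
a ROBUST CROSSING, with NO isolation and NO symmetry hypothesis.  Abstract inputs:
`Literature.Analysis.Calculus.malkin_implicit_family` (the family), `exists_cokernel_functional` (the cokernel
functional `ψ` read off the bordered inverse; `ker ψ ⊆ range T` without Fredholm theory), and
`robustCrossing_of_fold` (the saddle-node sign analysis of the EXACT identity `σ = ψ(B(z,z)) + ψ(frc(c' − c))`,
`z = υ − x₀`, valid because the steady lattice map is quadratic).  Pure proof file.
(Kielhöfer 2012 §I.4–I.5; Chow–Hale 1982 Ch. 6; Vanderbauwhede 1982 Ch. 8; Temam 1979 Ch. II §1.) -/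

-- `Summit.<Summit>.<Problem>` is the tree's mandated summit-side namespace (CONVENTIONS §2); for this
-- single-conjunct summit the two coincide, so the duplicate is deliberate.
set_option linter.dupNamespace false

noncomputable section

open scoped BigOperators Topology ENNReal NNReal InnerProductSpace ComplexConjugate
open Filter Set Function TopologicalSpace MeasureTheory UnitAddTorus

namespace Summit.AnomalousDissipation.AnomalousDissipation.Theorems.RobustLoudUpgrade.LsFold

open Literature.Analysis.FunctionSpaces Literature.Analysis.FunctionSpaces.Torus
open Literature.Analysis.FunctionSpaces.EuclideanSpace
open Literature.Analysis.FluidPDE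
open Literature.Analysis.FluidPDE.ScalarFourier
open Literature.Analysis.FluidPDE.SteadyLattice
open Literature.Analysis.Calculus
open Summit.AnomalousDissipation.AnomalousDissipation.Theses.BaireTransfer
open Summit.AnomalousDissipation.AnomalousDissipation.Theorems.RobustLoudUpgrade.SteadyPersist
open Summit.AnomalousDissipation.AnomalousDissipation.Theorems.RobustLoudUpgrade.LsFamily

section Family

set_option maxHeartbeats 3200000 in
/-- **Registered stub `stub_lsFold`: transversal folds of steady states are robust crossings** (Kielhöfer 2012
§I.4–I.5, Chow–Hale 1982 Ch. 6), classical formulation: see the module docstring. [folklore] -/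
theorem stub_lsFold :
    ∀ (S : Finset (Fin 3 → ℤ)) (c d : Coeff S) (ν : ℝ) (u₀ : UnitAddTorus (Fin 3) → EuclideanSpace ℝ (Fin 3))
      (p₀ : UnitAddTorus (Fin 3) → ℝ) (v h : UnitAddTorus (Fin 3) → EuclideanSpace ℝ (Fin 3)),
      0 < ν → Torus.IsSteadyNSState ν (force S c) u₀ p₀ → HasZeroMean u₀ →
      IsSmooth v → IsDivFree v → HasZeroMean v →
      (∀ w, Torus.LinNSResolventRel ν u₀ 0 w 0 → ∃ z : ℂ, w = z • cplx v) →
      IsSmooth h → IsDivFree h → HasZeroMean h →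
      (∀ w, ¬ Torus.LinNSResolventRel ν u₀ 0 w (cplx h)) →
      (∀ w, ¬ Torus.LinNSResolventRel ν u₀ 0 w (cplx (Torus.convect v v))) →
      (∀ w, ¬ Torus.LinNSResolventRel ν u₀ 0 w (cplx (force S d))) →
      ∃ σ : Coeff S × ℝ → ℝ,
        (∀ δ : ℝ, 0 < δ → ∃ r : ℝ, 0 < r ∧
          ∀ q ∈ Metric.ball (c, (0 : ℝ)) r, |σ q| < δ ∧
            ∃ (u' : UnitAddTorus (Fin 3) → EuclideanSpace ℝ (Fin 3)) (p' : UnitAddTorus (Fin 3) → ℝ),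
              Torus.IsSteadyNSState ν (fun y => force S q.1 y - σ q • h y) u' p' ∧ HasZeroMean u' ∧
                (∑' k : Fin 3 → ℤ, freqNormSq k ^ 2 *
                    ‖mFourierCoeff (complexify ∘ u') k - mFourierCoeff (complexify ∘ u₀) k‖ ^ 2) < δ ∧
                (∫ y, inner ℝ (v y) (u' y - u₀ y)) = q.2) ∧
        ∀ η : ℝ, 0 < η → ∃ (s x₁ x₂ : ℝ), dist (c + s • d) c < η ∧ |x₁| < η ∧ |x₂| < η ∧
          σ (c + s • d, x₁) < 0 ∧ 0 < σ (c + s • d, x₂) := by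
  intro S c d ν u₀ p₀ v h hν hst h0 hv₁ hv₂ hv₃ hker hh₁ hh₂ hh₃ hvis hfold hvisd
  -- §1 the unperturbed state on the Fourier side (verbatim from the template)
  have hu₀ : IsSmooth u₀ := hst.smooth_velocity.isSmooth_slice (Set.mem_univ 0)
  have hdiv₀ : IsDivFree u₀ := hst.divFree 0 (Set.mem_univ 0)
  set a : (Fin 3 → ℤ) → (EuclideanSpace ℂ (Fin 3)) := mFourierCoeff (complexify ∘ u₀) with ha
  have har : RapidDecay a := hu₀.complexify_comp.rapidDecay_mFourierCoeff
  have ha0 : a 0 = 0 := mFourierCoeff_complexify_zero_of_hasZeroMean hu₀ h0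
  -- §2 the state space, the bilinear map, the force map
  obtain ⟨W, hW, hWc⟩ := exists_space
  haveI : CompleteSpace W := completeSpace_W hWc
  obtain ⟨B, hB, hBb⟩ := exists_bilinear hW
  obtain ⟨Fm, hFm⟩ := exists_forceMap (S := S) hW
  -- §3 the base point `x₀`, the kernel vector `g`, the coefficient vector `e` of the border field
  obtain ⟨x₀, hcf⟩ := exists_stateVec hW hu₀ hdiv₀ h0
  obtain ⟨g, hg⟩ := exists_stateVec hW hv₁ hv₂ hv₃
  obtain ⟨e, he⟩ := exists_coeffVec hW hh₁ hh₂ hh₃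
  -- §4 the steady map and its derivative (verbatim from the template)
  set cν : ℝ := 4 * Real.pi ^ 2 * ν with hcν
  have hcν0 : cν ≠ 0 := by positivity
  set G : W → W := fun x => cν • x + B x x with hG
  set K : W →L[ℝ] W := (hBb.deriv (x₀, x₀)).comp ((ContinuousLinearMap.id ℝ W).prod (ContinuousLinearMap.id ℝ W))
    with hK
  have hKw : ∀ w, K w = B x₀ w + B w x₀ := fun w => by simp [hK, IsBoundedBilinearMap.deriv_apply]
  have hGd : HasStrictFDerivAt G (cν • ContinuousLinearMap.id ℝ W + K) x₀ := hasStrictFDerivAt_steadyMap hBb cν x₀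
  have hKc : IsCompactOperator K := isCompactOperator_linearised hWc hB x₀ (by rw [hcf]; exact har) K hKw
  have hGcd : ContDiffAt ℝ 1 G x₀ := by
    have h1 : ContDiff ℝ 1 (fun x : W => cν • x) := contDiff_id.const_smul cν
    have h2 : ContDiff ℝ 1 (fun x : W => B x x) :=
      (hBb.contDiff (n := 1)).comp (contDiff_id.prodMk contDiff_id)
    exact (h1.add h2).contDiffAt
  -- coordinates of `G`
  have hGcoe : ∀ x : W, (((G x : W) : (lp (fun _ : Fin 3 → ℤ => EuclideanSpace ℂ (Fin 3)) 2)) : (Fin 3 → ℤ) →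
      (EuclideanSpace ℂ (Fin 3))) = fun k => ((cν : ℝ) : ℂ) • ((x : (lp (fun _ : Fin 3 → ℤ => EuclideanSpace ℂ (Fin
      3)) 2)) : (Fin 3 → ℤ) → (EuclideanSpace ℂ (Fin 3))) k +
      Torus.lerayCoeff k ((WithLp.toLp 2 (fun pp : Fin 3 => transportSym (fun jj mm => (((fun mm : Fin 3 →
          ℤ => (((freqNormSq mm)⁻¹ : ℝ) : ℂ)) • (((x : (lp (fun _ : Fin 3 → ℤ => EuclideanSpace ℂ (Fin 3)) 2)) : (Fin
          3 → ℤ) → (EuclideanSpace ℂ (Fin 3))) : (Fin 3 → ℤ) → EuclideanSpace ℂ (Fin 3)))) mm jj) (fun mm => (((fun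
          mm : Fin 3 → ℤ => (((freqNormSq mm)⁻¹ : ℝ) : ℂ)) • (((x : (lp (fun _ : Fin 3 → ℤ => EuclideanSpace ℂ (Fin
          3)) 2)) : (Fin 3 → ℤ) → (EuclideanSpace ℂ (Fin 3))) : (Fin 3 → ℤ) → EuclideanSpace ℂ (Fin 3)))) mm pp) k) :
          EuclideanSpace ℂ (Fin 3))) := by
    intro x
    rw [hG]
    dsimp only
    rw [coeW_add, coeW_smul, hB]
    funext k
    simp only [Pi.add_apply, Pi.smul_apply, Complex.coe_smul]
  -- coordinates of the linearisation `T = cν·1 + K`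
  set T : W →L[ℝ] W := cν • ContinuousLinearMap.id ℝ W + K with hT
  have hTw : ∀ w : W, T w = cν • w + K w := fun w => by simp [hT]
  have hTcoe : ∀ (w : W) (k : (Fin 3 → ℤ)), (((T w : W) : (lp (fun _ : Fin 3 → ℤ => EuclideanSpace ℂ (Fin 3)) 2)) :
      (Fin 3 → ℤ) → (EuclideanSpace ℂ (Fin 3))) k =
      (((4 * Real.pi ^ 2 * ν : ℝ)) : ℂ) • ((w : (lp (fun _ : Fin 3 → ℤ => EuclideanSpace ℂ (Fin 3)) 2)) : (Fin 3 → ℤ)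
          → (EuclideanSpace ℂ (Fin 3))) k +
        Torus.lerayCoeff k ((WithLp.toLp 2 (fun pp : Fin 3 => transportSym (fun jj mm => a mm jj) (fun mm => (((fun
            mm : Fin 3 → ℤ => (((freqNormSq mm)⁻¹ : ℝ) : ℂ)) • (((w : (lp (fun _ : Fin 3 → ℤ => EuclideanSpace ℂ (Fin
            3)) 2)) : (Fin 3 → ℤ) → (EuclideanSpace ℂ (Fin 3))) : (Fin 3 → ℤ) → EuclideanSpace ℂ (Fin 3)))) mm pp)
            k) : EuclideanSpace ℂ (Fin 3)) + (WithLp.toLp 2 (fun pp : Fin 3 => transportSym (fun jj mm => (((fun mm :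
            Fin 3 → ℤ => (((freqNormSq mm)⁻¹ : ℝ) : ℂ)) • (((w : (lp (fun _ : Fin 3 → ℤ => EuclideanSpace ℂ (Fin 3))
            2)) : (Fin 3 → ℤ) → (EuclideanSpace ℂ (Fin 3))) : (Fin 3 → ℤ) → EuclideanSpace ℂ (Fin 3)))) mm jj) (fun
            mm => a mm pp) k) : EuclideanSpace ℂ (Fin 3))) := by
    intro w k
    rw [hTw, coeW_add, hKw, coeW_add, coeW_smul, hB, hB, hcf]
    simp only [Pi.add_apply, Pi.smul_apply]
    rw [← lerayCoeff_add', ← Complex.coe_smul]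
  -- §5 lattice solutions of `T x = −Π ĝ` are classical solutions of `L(ν,u₀) w = g`
  have hsolveT : ∀ (x : W) (gf : (UnitAddTorus (Fin 3)) → (EuclideanSpace ℂ (Fin 3))), IsSmooth gf →
      mFourierCoeff gf 0 = 0 →
      (∀ k : (Fin 3 → ℤ), (((T x : W) : (lp (fun _ : Fin 3 → ℤ => EuclideanSpace ℂ (Fin 3)) 2)) : (Fin 3 → ℤ) →
        (EuclideanSpace ℂ (Fin 3))) k = -Torus.lerayCoeff k (mFourierCoeff gf k)) →
      ∃ w, Torus.LinNSResolventRel ν u₀ 0 w gf ∧ mFourierCoeff w = ((fun mm : Fin 3 → ℤ => (((freqNormSq mm)⁻¹ :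
        ℝ) : ℂ)) • (((x : (lp (fun _ : Fin 3 → ℤ => EuclideanSpace ℂ (Fin 3)) 2)) : (Fin 3 → ℤ) → (EuclideanSpace ℂ
        (Fin 3))) : (Fin 3 → ℤ) → EuclideanSpace ℂ (Fin 3))) := by
    intro x gf hgs hg0 hco
    exact exists_linNSResolventRel_of_latticeEq hν hu₀ hdiv₀ hgs hg0
      (x : (lp (fun _ : Fin 3 → ℤ => EuclideanSpace ℂ (Fin 3)) 2)) (W_zero hW x) (W_trans hW x)
      (fun k => by rw [← hTcoe]; exact hco k)
  have hcplx : ∀ u : (UnitAddTorus (Fin 3)) → (EuclideanSpace ℝ (Fin 3)), cplx u = complexify ∘ u := fun u => by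
    funext y; simp only [cplx, Function.comp_apply, realToComplex_eq_complexify]
  -- kernel transfer: `T x = 0 ⇒ x ∈ ℝ·g`
  have hVcs : IsConjSymm (mFourierCoeff (complexify ∘ v)) := isConjSymm_mFourierCoeff hv₁.integrable
  have hkerT : ∀ x : W, T x = 0 → ∃ z : ℝ, x = z • g := by
    intro x hx
    have hz : ∀ k, mFourierCoeff (0 : (UnitAddTorus (Fin 3)) → (EuclideanSpace ℂ (Fin 3))) k = 0 := fun k => by
      rw [show (0 : (UnitAddTorus (Fin 3)) → (EuclideanSpace ℂ (Fin 3))) = (0 : ℂ) • (0 : (UnitAddTorus (Fin 3)) →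
          (EuclideanSpace ℂ (Fin 3))) by simp, mFourierCoeff_const_smul, zero_smul]
    obtain ⟨w, hrel, hŵ⟩ := hsolveT x 0 (isSmooth_const (0 : (EuclideanSpace ℂ (Fin 3)))) (hz 0) (fun k => by
      rw [hx, Submodule.coe_zero, hz, lerayCoeff_zero_vec, neg_zero]; rfl)
    obtain ⟨z, hwz⟩ := hker w hrel
    have hcfx : ∀ k, (((fun mm : Fin 3 → ℤ => (((freqNormSq mm)⁻¹ : ℝ) : ℂ)) • (((x : (lp (fun _ : Fin 3 →
        ℤ => EuclideanSpace ℂ (Fin 3)) 2)) : (Fin 3 → ℤ) → (EuclideanSpace ℂ (Fin 3))) : (Fin 3 → ℤ) → EuclideanSpace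
        ℂ (Fin 3)))) k = z • mFourierCoeff (complexify ∘ v) k := by
      intro k
      rw [← hŵ, hwz, hcplx, mFourierCoeff_const_smul]
    have hre := eq_re_smul_of_isConjSymm (isConjSymm_cf (W_conj hW x)) hVcs hcfx
    refine ⟨z.re, Subtype.ext (lp.ext ?_)⟩
    refine eq_of_cf_eq (W_zero hW x) (W_zero hW (z.re • g)) ?_
    rw [coeW_smul, cf_real_smul, hg]
    funext k
    rw [hre k, Pi.smul_apply]
  -- §6 range transfer: `T x ≠ −Fm d` for a visible force direction, `T x ≠ −e` for the visible border field
  set FmL : Coeff S →L[ℝ] W := LinearMap.toContinuousLinearMap Fm with hFmL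
  have hFmL : ∀ d, FmL d = Fm d := fun d => rfl
  have hrangeF : ∀ d : Coeff S, (∀ w, ¬ Torus.LinNSResolventRel ν u₀ 0 w (cplx (force S d))) →
      ∀ x : W, T x ≠ (-FmL) d := by
    intro d hvisd x hx
    obtain ⟨w, hrel, -⟩ := hsolveT x (complexify ∘ force S d) (isSmooth_force' d).complexify_comp
      (mFourierCoeff_complexify_zero_of_hasZeroMean (isSmooth_force' d) (hasZeroMean_force' d)) (fun k => by
        rw [hx, neg_apply, hFmL, Submodule.coe_neg, lp.coeFn_neg, Pi.neg_apply, hFm, lerayCoeff_forceCoeff])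
    exact hvisd w (by rw [hcplx]; exact hrel)
  have hrangeT : ∀ x : W, T x ≠ -e := by
    intro x hx
    obtain ⟨w, hrel, -⟩ := hsolveT x (complexify ∘ h) hh₁.complexify_comp
      (mFourierCoeff_complexify_zero_of_hasZeroMean hh₁ hh₃) (fun k => by
        rw [hx, Submodule.coe_neg, lp.coeFn_neg, Pi.neg_apply, he, lerayCoeff_coeff hh₁ hh₂ hh₃])
    exact hvis w (by rw [hcplx]; exact hrel)
  -- §7 the isomorphism `J = cν·1`, compactness of `T − J = K`, and: `T` is not injective
  set J : W ≃L[ℝ] W := ContinuousLinearEquiv.equivOfInverse (cν • ContinuousLinearMap.id ℝ W)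
    (cν⁻¹ • ContinuousLinearMap.id ℝ W)
    (fun x => by
      change cν⁻¹ • (cν • x) = x
      rw [smul_smul, inv_mul_cancel₀ hcν0, one_smul])
    (fun x => by
      change cν • (cν⁻¹ • x) = x
      rw [smul_smul, mul_inv_cancel₀ hcν0, one_smul]) with hJ
  have hTJ : (T - (J : W →L[ℝ] W) : W →L[ℝ] W) = K := by
    ext w
    simp [hT, hJ]
  have hKTJ : IsCompactOperator (T - (J : W →L[ℝ] W) : W →L[ℝ] W) := by rw [hTJ]; exact hKc
  have hJ0 : ∀ _hinj : Injective T, False := by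
    intro hinj
    obtain ⟨x, hx⟩ := (bijective_of_injective_of_isCompactOperator T J hKTJ hinj).2 (-e)
    exact hrangeT x hx
  -- §8 the phase functional `φ = ∫⟪v, ·⟫` and `φ g ≠ 0`
  obtain ⟨φ₀, hφ₀⟩ := lsFamily_phaseFunctional v hv₁
  set φ : W →L[ℝ] ℝ := φ₀.comp W.subtypeL with hφ
  have hφw : ∀ x : W, φ x = φ₀ (x : (lp (fun _ : Fin 3 → ℤ => EuclideanSpace ℂ (Fin 3)) 2)) := fun x => rfl
  have hgne : g ≠ 0 := by
    intro hg0
    refine hJ0 ?_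
    rw [injective_iff_map_eq_zero]
    intro x hx
    obtain ⟨z, rfl⟩ := hkerT x hx
    rw [hg0, smul_zero]
  have hvne : v ≠ 0 := by
    intro hv0
    apply hgne
    refine Subtype.ext (lp.ext ?_)
    refine eq_of_cf_eq (W_zero hW g) (W_zero hW (0 : W)) ?_
    rw [hg, hv0, Submodule.coe_zero]
    funext k
    rw [cf_apply, lp.coeFn_zero, Pi.zero_apply, smul_zero]
    rw [show (complexify ∘ (0 : (UnitAddTorus (Fin 3)) → (EuclideanSpace ℝ (Fin 3)))) = (0 : ℂ) • (0 : (UnitAddTorus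
        (Fin 3)) → (EuclideanSpace ℂ (Fin 3))) by funext y; simp, mFourierCoeff_const_smul, zero_smul]
  have hφg : φ g ≠ 0 := by
    rw [hφw, hφ₀ _ v hv₁ hg]
    intro hint
    have hint' : (∫ y, ‖v y‖ ^ 2) ≤ 0 := by
      have e : (fun y => inner ℝ (v y) (v y)) = fun y => ‖v y‖ ^ 2 := by
        funext y; rw [real_inner_self_eq_norm_sq]
      rw [e] at hint
      exact hint.le
    exact hvne (eq_zero_of_integral_norm_sq_nonpos hv₁ hint')
  -- §9 the base equation and the abstract Lyapunov–Schmidt family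
  have heq₀ : ∀ k : (Fin 3 → ℤ), (((ν * (4 * Real.pi ^ 2 * freqNormSq k)) : ℝ) : ℂ) • a k + Torus.lerayCoeff k
      ((WithLp.toLp 2 (fun pp : Fin 3 => transportSym (fun jj mm => a mm jj) (fun mm => a mm pp) k) : EuclideanSpace ℂ
      (Fin 3))) =
      mFourierCoeff (complexify ∘ force S c) k := fun k => by
    rw [ha, fourier_eq_of_isSteadyNSState hst (isSmooth_force' c) h0 k, lerayCoeff_forceCoeff]
  have hGx₀ : G x₀ = Fm c := by
    refine Subtype.ext (lp.ext (funext fun k => ?_))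
    rw [hGcoe, hFm]
    dsimp only
    rw [smul_eq_weight_smul_cf (W_zero hW x₀) k, hcf]
    exact heq₀ k
  have h00 : G x₀ + (-FmL) c = 0 := by
    rw [neg_apply, hFmL, hGx₀, add_neg_cancel]
  obtain ⟨σ, υ, ℓ, r, hr, hσ0, hυ0, hσℓ, hσd, hυd, hℓ01, -, hσc, -, hsol, -⟩ :=
    malkin_implicit_family G (-FmL) T J φ x₀ g c (-e) hGcd hGd.hasFDerivAt h00 hKTJ hkerT hrangeT hφg
  -- bookkeeping shared by the family clause and the uniqueness clause: a lattice solution of the corrected equation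
  -- is a classical steady state of the corrected force
  have hforceEq : ∀ (x : W) (c' : Coeff S) (t : ℝ), G x = Fm c' - t • e → ∀ k : (Fin 3 → ℤ),
      (((4 * Real.pi ^ 2 * ν : ℝ)) : ℂ) • ((x : (lp (fun _ : Fin 3 → ℤ => EuclideanSpace ℂ (Fin 3)) 2)) : (Fin 3 → ℤ)
        → (EuclideanSpace ℂ (Fin 3))) k +
      Torus.lerayCoeff k ((WithLp.toLp 2 (fun pp : Fin 3 => transportSym (fun jj mm => (((fun mm : Fin 3 →
          ℤ => (((freqNormSq mm)⁻¹ : ℝ) : ℂ)) • (((x : (lp (fun _ : Fin 3 → ℤ => EuclideanSpace ℂ (Fin 3)) 2)) : (Fin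
          3 → ℤ) → (EuclideanSpace ℂ (Fin 3))) : (Fin 3 → ℤ) → EuclideanSpace ℂ (Fin 3)))) mm jj) (fun mm => (((fun
          mm : Fin 3 → ℤ => (((freqNormSq mm)⁻¹ : ℝ) : ℂ)) • (((x : (lp (fun _ : Fin 3 → ℤ => EuclideanSpace ℂ (Fin
          3)) 2)) : (Fin 3 → ℤ) → (EuclideanSpace ℂ (Fin 3))) : (Fin 3 → ℤ) → EuclideanSpace ℂ (Fin 3)))) mm pp) k) :
          EuclideanSpace ℂ (Fin 3))) =
      mFourierCoeff (complexify ∘ fun y => force S c' y - t • h y) k := by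
    intro x c' t hGx k
    have h1 := congrArg (fun z : W => (((z : W) : (lp (fun _ : Fin 3 → ℤ => EuclideanSpace ℂ (Fin 3)) 2)) : (Fin 3 → ℤ)
        → (EuclideanSpace ℂ (Fin 3))) k) hGx
    dsimp only at h1
    rw [hGcoe, coeW_sub, coeW_smul, Pi.sub_apply, Pi.smul_apply, hFm, he, ← Complex.coe_smul] at h1
    rw [mFourierCoeff_sub_smul (isSmooth_force' _) hh₁]
    exact h1
  -- §10 the cokernel functional `ψ` of the bordered inverse and the quadratic structure of `G`
  have hDb := bordered_bijective T J hKTJ g (-e) φ hkerT hrangeT hφg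
  obtain ⟨ψ, hψT, hψe, hψker⟩ := exists_cokernel_functional T φ (-e) hDb hrangeT
  set A : W →L[ℝ] W := cν • ContinuousLinearMap.id ℝ W with hA
  set Bc : W →L[ℝ] W →L[ℝ] W := hBb.toContinuousLinearMap with hBc
  have hBcw : ∀ x y : W, Bc x y = B x y := fun x y => rfl
  have hAw : ∀ x : W, A x = cν • x := fun x => rfl
  have hTform : ∀ w : W, T w = A w + Bc x₀ w + Bc w x₀ := fun w => by
    rw [hTw, hKw, hBcw, hBcw, hAw, ← add_assoc]
  have hGAB : ∀ x : W, G x = A x + Bc x x := fun x => by rw [hBcw, hAw]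
  have h0' : A x₀ + Bc x₀ x₀ + (-FmL) c = 0 := by rw [← hGAB]; exact h00
  have hsol' : ∀ q ∈ Metric.ball ((c, 0) : Coeff S × ℝ) r, A (υ q) + Bc (υ q) (υ q) + (-FmL) q.1 - σ q • (-e) = 0 :=
    fun q hq => by rw [← hGAB]; exact (hsol q hq).1
  -- §11 first-order data of the family: `T (Dυ w) − Fm w.1 + ℓ w • e = 0`, `φ (Dυ w) = w.2`
  set Dυ : Coeff S × ℝ →L[ℝ] W := fderiv ℝ υ (c, 0) with hDυ
  have hυd' : HasFDerivAt υ Dυ (c, 0) := (hυd.differentiableAt one_ne_zero).hasFDerivAt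
  have hball0 : Metric.ball ((c, 0) : Coeff S × ℝ) r ∈ 𝓝 ((c, 0) : Coeff S × ℝ) := Metric.ball_mem_nhds _ hr
  have hDid : ∀ w' : Coeff S × ℝ, T (Dυ w') + (-FmL) w'.1 - (ℓ w') • (-e) = 0 ∧ φ (Dυ w') = w'.2 := by
    intro w'
    -- the two identities hold near `(c, 0)`, hence have zero derivative there
    have hF₁ : HasFDerivAt (fun q : Coeff S × ℝ => G (υ q) + (-FmL) q.1 - σ q • (-e))
        (T.comp Dυ + (-FmL).comp (ContinuousLinearMap.fst ℝ (Coeff S) ℝ) - ℓ.smulRight (-e)) (c, 0) := by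
      have h1 : HasFDerivAt (fun q : Coeff S × ℝ => G (υ q)) (T.comp Dυ) (c, 0) := by
        have hG' : HasFDerivAt G T (υ (c, 0)) := by rw [hυ0]; exact hGd.hasFDerivAt
        exact hG'.comp (c, 0) hυd'
      have h2 : HasFDerivAt (fun q : Coeff S × ℝ => (-FmL) q.1) ((-FmL).comp (ContinuousLinearMap.fst ℝ (Coeff S) ℝ))
          (c, 0) := ((-FmL).hasFDerivAt).comp (c, 0) hasFDerivAt_fst
      exact (h1.add h2).sub (hσℓ.smul_const (-e))
    have hZ₁ : HasFDerivAt (fun q : Coeff S × ℝ => G (υ q) + (-FmL) q.1 - σ q • (-e))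
        (0 : Coeff S × ℝ →L[ℝ] W) (c, 0) :=
      (hasFDerivAt_const (0 : W) (c, 0)).congr_of_eventuallyEq
        (Filter.mem_of_superset hball0 fun q hq => (hsol q hq).1)
    have hE₁ := congrArg (fun L : Coeff S × ℝ →L[ℝ] W => L w') (hF₁.unique hZ₁)
    have hF₂ : HasFDerivAt (fun q : Coeff S × ℝ => φ (υ q - x₀) - q.2)
        (φ.comp Dυ - ContinuousLinearMap.snd ℝ (Coeff S) ℝ) (c, 0) := by
      have h1 : HasFDerivAt (fun q : Coeff S × ℝ => φ (υ q - x₀)) (φ.comp Dυ) (c, 0) :=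
        (φ.hasFDerivAt).comp (c, 0) (hυd'.sub_const x₀)
      exact h1.sub hasFDerivAt_snd
    have hZ₂ : HasFDerivAt (fun q : Coeff S × ℝ => φ (υ q - x₀) - q.2) (0 : Coeff S × ℝ →L[ℝ] ℝ) (c, 0) :=
      (hasFDerivAt_const (0 : ℝ) (c, 0)).congr_of_eventuallyEq
        (Filter.mem_of_superset hball0 fun q hq => by
          show φ (υ q - x₀) - q.2 = 0
          rw [(hsol q hq).2, sub_self])
    have hE₂ := congrArg (fun L : Coeff S × ℝ →L[ℝ] ℝ => L w') (hF₂.unique hZ₂)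
    simp only [add_apply, sub_apply, ContinuousLinearMap.comp_apply, ContinuousLinearMap.smulRight_apply, zero_apply,
      ContinuousLinearMap.coe_fst', ContinuousLinearMap.coe_snd'] at hE₁ hE₂
    exact ⟨hE₁, sub_eq_zero.1 hE₂⟩
  -- the kernel direction of the family: `g₁ = Dυ (0,1) = (φ g)⁻¹ • g`
  have hg₁T : T (Dυ (0, 1)) = 0 := by
    have h1 := (hDid (0, 1)).1
    rw [hℓ01, zero_smul, sub_zero, map_zero, add_zero] at h1
    exact h1
  have hg₁φ : φ (Dυ (0, 1)) = 1 := (hDid (0, 1)).2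
  obtain ⟨μ, hμ⟩ := hkerT _ hg₁T
  have hμ1 : μ * φ g = 1 := by rw [← smul_eq_mul, ← map_smul, ← hμ]; exact hg₁φ
  have hμ0 : μ ≠ 0 := by rintro rfl; simp at hμ1
  -- §12 the two jet hypotheses on the lattice: `ψ (B g g) ≠ 0` (fold), `ψ (Fm d) ≠ 0` (visibility of `d`)
  have hBgg : ∀ x : W, T x ≠ Bc g g := by
    intro x hx
    have hneg : T (-x) = -(Bc g g) := by rw [map_neg, hx]
    obtain ⟨w, hrel, -⟩ := hsolveT (-x) (complexify ∘ Torus.convect v v) (hv₁.convect hv₁).complexify_comp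
      (mFourierCoeff_complexify_zero_of_hasZeroMean (hv₁.convect hv₁) (integral_convect_self_eq_zero hv₁ hv₂))
      (fun k => by
        rw [hneg, Submodule.coe_neg, lp.coeFn_neg, Pi.neg_apply, hBcw, hB, hg, mFourierCoeff_convect_real hv₁ hv₁])
    exact hfold w (by rw [hcplx]; exact hrel)
  have ha : ψ (Bc (Dυ (0, 1)) (Dυ (0, 1))) ≠ 0 := by
    have hBsm : Bc (μ • g) (μ • g) = (μ * μ) • Bc g g := by rw [map_smul, map_smul, smul_apply, smul_smul]
    rw [hμ, hBsm, map_smul, smul_eq_mul]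
    refine mul_ne_zero (mul_ne_zero hμ0 hμ0) fun h0 => ?_
    obtain ⟨w, hw⟩ := hψker _ h0
    exact hBgg w hw
  have hb : ψ ((-FmL) d) ≠ 0 := fun h0 => by
    obtain ⟨w, hw⟩ := hψker _ h0
    exact hrangeF d hvisd w hw
  -- §13 conclusions
  refine ⟨σ, fun δ hδ => ?_, ?_⟩
  · -- the existence data that pins `σ` classically (as in `stub_lsFamily`, without the `H¹` clause)
    set δ' : ℝ := min 1 δ with hδ'
    have hδ'0 : 0 < δ' := lt_min one_pos hδ
    have hδ'1 : δ' ≤ 1 := min_le_left _ _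
    have hδ'2 : δ' ≤ δ := min_le_right _ _
    obtain ⟨r₁, hr₁, hball₁⟩ := Metric.continuousAt_iff.1 hυd.continuousAt δ' hδ'0
    obtain ⟨r₂, hr₂, hball₂⟩ := Metric.continuousAt_iff.1 hσd.continuousAt δ hδ
    refine ⟨min r (min r₁ r₂), lt_min hr (lt_min hr₁ hr₂), fun q hq => ?_⟩
    have hqr : q ∈ Metric.ball ((c, 0) : Coeff S × ℝ) r := Metric.ball_subset_ball (min_le_left _ _) hq
    have hq₁ : dist q (c, 0) < r₁ := lt_of_lt_of_le (Metric.mem_ball.1 hq) ((min_le_right _ _).trans (min_le_left _ _))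
    have hq₂ : dist q (c, 0) < r₂ :=
      lt_of_lt_of_le (Metric.mem_ball.1 hq) ((min_le_right _ _).trans (min_le_right _ _))
    have hσq : |σ q| < δ := by
      have := hball₂ hq₂
      rwa [hσ0, Real.dist_eq, sub_zero] at this
    refine ⟨hσq, ?_⟩
    obtain ⟨x, hx⟩ : ∃ x : W, υ q = x := ⟨_, rfl⟩
    have hGx : G x = Fm q.1 - σ q • e := by
      have h1 := (hsol q hqr).1
      rw [hx, neg_apply, hFmL, smul_neg, sub_neg_eq_add] at h1
      rw [← sub_eq_zero, ← h1]
      abel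
    have hFs : IsSmooth (fun y => force S q.1 y - σ q • h y) := isSmooth_sub_smul (isSmooth_force' _) hh₁ _
    have hFd : IsDivFree (fun y => force S q.1 y - σ q • h y) :=
      isDivFree_sub_smul (isSmooth_force' _) hh₁ (isDivFree_force' _) hh₂ _
    have hF0 : HasZeroMean (fun y => force S q.1 y - σ q • h y) :=
      hasZeroMean_sub_smul (isSmooth_force' _) hh₁ (hasZeroMean_force' _) hh₃ _
    obtain ⟨u', p', hst', hmean', hu', hû'⟩ := exists_steadyState_of_latticeEq hν hFs hFd hF0
      (x : (lp (fun _ : Fin 3 → ℤ => EuclideanSpace ℂ (Fin 3)) 2)) (W_zero hW x) (W_trans hW x) (W_conj hW x)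
      (hforceEq x q.1 (σ q) hGx)
    refine ⟨u', p', hst', hmean', ?_, ?_⟩
    · -- the lattice estimate
      rw [latticeDist_eq_norm_sq hW hu' hu₀ x x₀ hû'.symm hcf]
      have hzn : ‖x - x₀‖ < δ' := by
        rw [← dist_eq_norm]
        have := hball₁ hq₁
        rwa [hυ0, hx] at this
      have h2 : ‖x - x₀‖ ^ 2 < δ' ^ 2 := pow_lt_pow_left₀ hzn (norm_nonneg _) two_ne_zero
      have hd : δ' ^ 2 ≤ δ' := by rw [sq]; exact mul_le_of_le_one_left hδ'0.le hδ'1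
      exact lt_of_lt_of_le h2 (hd.trans hδ'2)
    · -- the phase
      have h1 := (hsol q hqr).2
      rw [hφw, hx] at h1
      have hcoefv := cf_sub_eq hu' hu₀ x x₀ hû'.symm hcf
      rw [hφ₀ _ (fun y => u' y - u₀ y) (hu'.sub hu₀) hcoefv.symm] at h1
      exact h1
  · intro η hη
    obtain ⟨s, x₁, x₂, hs, hx₁, hx₂, -, -, hσ₁, hσ₂⟩ :=
      robustCrossing_of_fold A Bc T (-FmL) x₀ c d (-e) ψ σ υ Dυ r hTform hψT hψe h0' hr hυ0 hυd' hσc hsol' ha hb η hη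
    exact ⟨s, x₁, x₂, hs, hx₁, hx₂, hσ₁, hσ₂⟩

end Family

end Summit.AnomalousDissipation.AnomalousDissipation.Theorems.RobustLoudUpgrade.LsFold

end
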